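import Mathlib
import Summits.Ventures.HodgeRepro.FaceCensusEngine
import Summits.Ventures.HodgeRepro.CMType
import Summits.Ventures.HodgeRepro.HodgeSets
import Summits.Ventures.HodgeRepro.CMRank
import Summits.Ventures.HodgeRepro.Primitive
import Summits.Ventures.HodgeRepro.MuTable
import Summits.Ventures.HodgeRepro.EngineBridge
import Summits.Ventures.HodgeRepro.Faces

/-!
# Faces and their μ-table (blind cell `pub-hodge-repro`, seat p2)

A *face* of the sealer's engine is `(Φ; π, π′)`: a CM type and two distinct places `{g, c g}`; its four
*corners* are the CM types `Φ, (Φ̄)^{(π)}, (Φ̄)^{(π′)}, Φ^{(ππ′)}` (flip = symmetric difference with the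
place).  The μ-table of the face is the `4 × n` table `[s ∈ corner_i]`; the engine's `sumTwo` says that
every column sums to `2`.  Here this is proved for EVERY face of EVERY `(G, c)` (model form
`sum_ind_corners` and engine form `sumTwo_eq_true`): by Deligne LNM 900 §5 (c) / Milne 2020 §2.2 the
corner product `∏ A_{corner_i}` is then of split Weil type with a `(2,2)`-line (the condition
`Σ_i Φ_i = d/2`, `d = 4`).  The engine's `noConjugateCorners` is read as: no corner is the complex
conjugate of another.
-/

set_option autoImplicit false

open Finset
open scoped Pointwise symmDiff

namespace HodgeRepro

variable {G : Type*} [Group G] [DecidableEq G]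

/-! ### Places, flips and corners in the model (`place` / `mem_place` are typer's, from `Faces.lean`) -/

/-- Flip of a type at a place (symmetric difference). -/
def flip (π T : Finset G) : Finset G := symmDiff T π

/-- The four corners `Φ, (Φ̄)^{(π)}, (Φ̄)^{(π′)}, Φ^{(ππ′)}` of the face `(Φ; π, π′)`. -/
def cornersM (c : G) (Φ π π' : Finset G) : Fin 4 → Finset G :=
  ![Φ, flip π (c • Φ), flip π' (c • Φ), flip π' (flip π Φ)]

omit [Group G] in
/-- Membership in a flip: `x ∈ T` exactly when `x ∉ π`, and conversely. -/
theorem mem_flip {π T : Finset G} {x : G} : x ∈ flip π T ↔ (x ∈ T ↔ x ∉ π) := by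
  unfold flip
  rw [mem_symmDiff]
  tauto

/-- A flip of a CM type at a place is a CM type. -/
theorem IsCMType.flip_place {c : G} {Φ : Finset G} (hc : IsComplexConj c) (hΦ : IsCMType c Φ) (g : G) :
    IsCMType c (flip (place c g) Φ) := by
  intro x
  have hstab : x ∈ place c g ↔ c * x ∈ place c g := by
    rw [mem_place, mem_place]
    constructor
    · rintro (rfl | rfl)
      · exact Or.inr rfl
      · left; exact hc.mul_mul_cancel g
    · rintro (h | h)
      · right; rw [← h, hc.mul_mul_cancel]
      · left; exact mul_left_cancel h
  have hx := hΦ x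
  rw [mem_flip, mem_flip]
  tauto

/-- Two places are either equal or disjoint. -/
theorem place_eq_or_disjoint {c : G} (hc : IsComplexConj c) (g h : G) :
    place c g = place c h ∨ Disjoint (place c g) (place c h) := by
  by_cases hgh : g = h ∨ g = c * h
  · left
    ext x
    rw [mem_place, mem_place]
    rcases hgh with rfl | rfl
    · rfl
    · rw [hc.mul_mul_cancel]; tauto
  · right
    rw [disjoint_left]
    intro x hx hx'
    rw [mem_place] at hx hx'
    apply hgh
    rcases hx with rfl | rfl <;> rcases hx' with h1 | h1
    · exact Or.inl h1
    · exact Or.inr h1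
    · right; rw [← h1, hc.mul_mul_cancel]
    · left; exact mul_left_cancel h1

/-! ### The μ-table of a face: every column sums to two -/

/-- **SumTwo** (model form, pointwise).  If `c • Φ = Φᶜ` (a CM type) and `π, π′` are disjoint, every `x`
lies in exactly two of the four corners `Φ, (Φ̄)^{(π)}, (Φ̄)^{(π′)}, Φ^{(ππ′)}`. -/
theorem sum_four_corners {c : G} {Φ π π' : Finset G} (hbar : ∀ y, y ∈ c • Φ ↔ y ∉ Φ) (hd : Disjoint π π')
    (x : G) :
    (if x ∈ Φ then 1 else 0) + (if x ∈ flip π (c • Φ) then 1 else 0) +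
      (if x ∈ flip π' (c • Φ) then 1 else 0) + (if x ∈ flip π' (flip π Φ) then 1 else 0) = 2 := by
  have hnot : ¬ (x ∈ π ∧ x ∈ π') := fun h => disjoint_left.1 hd h.1 h.2
  simp only [mem_flip, hbar]
  by_cases h1 : x ∈ Φ <;> by_cases h2 : x ∈ π <;> by_cases h3 : x ∈ π' <;> simp [h1, h2, h3] <;> tauto

/-- For a CM type `Φ`, `y ∈ c • Φ` exactly when `y ∉ Φ`. -/
theorem smul_mem_iff_of_isCMType [Fintype G] {c : G} {Φ : Finset G} (hc : IsComplexConj c)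
    (hΦ : IsCMType c Φ) (y : G) : y ∈ c • Φ ↔ y ∉ Φ := by
  rw [hΦ.smul_eq_compl hc, mem_compl]

/-- **SumTwo** for a CM type and two disjoint places: the column `x` of the μ-table of the face has sum `2`
(exactly two of the four corners contain `x`). -/
theorem card_filter_mem_corners [Fintype G] {c : G} {Φ π π' : Finset G} (hc : IsComplexConj c)
    (hΦ : IsCMType c Φ) (hd : Disjoint π π') (x : G) :
    (univ.filter fun i : Fin 4 => x ∈ cornersM c Φ π π' i).card = 2 := by
  rw [card_filter, Fin.sum_univ_four]
  simp only [cornersM, Matrix.cons_val_zero, Matrix.cons_val_one, Matrix.head_cons, Matrix.cons_val_two,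
    Matrix.tail_cons, Matrix.cons_val_three]
  exact sum_four_corners (smul_mem_iff_of_isCMType hc hΦ) hd x

/-- The μ-table of a face in the typer's indicator vocabulary: `Σ_i ind (corner_i) = 2` (Deligne §5 (c) with
`d = 4`: the corner product is of split Weil type). -/
theorem sum_ind_corners [Fintype G] {c : G} {Φ π π' : Finset G} (hc : IsComplexConj c)
    (hΦ : IsCMType c Φ) (hd : Disjoint π π') :
    ∑ i : Fin 4, ind (cornersM c Φ π π' i) = fun _ => (2 : ℚ) := by
  ext x
  rw [Finset.sum_apply, Fin.sum_univ_four]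
  simp only [cornersM, Matrix.cons_val_zero, Matrix.cons_val_one, Matrix.head_cons, Matrix.cons_val_two,
    Matrix.tail_cons, Matrix.cons_val_three, ind_apply]
  have h := sum_four_corners (smul_mem_iff_of_isCMType hc hΦ) hd x
  have hcast : ((if x ∈ Φ then 1 else 0) + (if x ∈ flip π (c • Φ) then 1 else 0) +
      (if x ∈ flip π' (c • Φ) then 1 else 0) + (if x ∈ flip π' (flip π Φ) then 1 else 0) : ℕ) = 2 := h
  have := congrArg (fun m : ℕ => (m : ℚ)) hcast
  push_cast at this
  exact this

/-! ### The engine's `sumTwo` and `noConjugateCorners`, read in the model -/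

namespace EngineBridge

open Summit.Ventures.HodgeRepro Summit.Ventures.HodgeRepro.FaceCensus

variable {n : ℕ}

/-- The length of a filtered four-element list as a sum of four indicators. -/
theorem length_filter_four (p : ℕ → Bool) (a b c d : ℕ) :
    ([a, b, c, d].filter p).length =
      (if p a then 1 else 0) + (if p b then 1 else 0) + (if p c then 1 else 0) + (if p d then 1 else 0) := by
  cases ha : p a <;> cases hb : p b <;> cases hc : p c <;> cases hd : p d <;>
    simp [ha, hb, hc, hd]

/-- `sumTwo f` says: every index lies in exactly two corners. -/
theorem sumTwo_iff (Γ : CMGaloisType n) (f : ℕ × ℕ × ℕ) :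
    Γ.sumTwo f = true ↔ ∀ i : Fin n,
      (if mem i f.1 then 1 else 0) + (if mem i (FaceCensus.flipAt f.2.1 (Γ.bar f.1)) then 1 else 0) +
        (if mem i (FaceCensus.flipAt f.2.2 (Γ.bar f.1)) then 1 else 0) +
        (if mem i (FaceCensus.flipAt f.2.2 (FaceCensus.flipAt f.2.1 f.1)) then 1 else 0) = 2 := by
  simp only [CMGaloisType.sumTwo, List.all_eq_true, List.mem_finRange, true_implies, beq_iff_eq,
    CMGaloisType.corners, length_filter_four]

/-- The corners of an engine face are the model corners of the corresponding finsets. -/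
theorem finsetOf_corners (Γ : CMGaloisType n) [Fact (Γ.isCMGaloisType = true)] (f : ℕ × ℕ × ℕ) :
    (finsetOf Γ f.1 = cornersM (Elt.conj Γ) (finsetOf Γ f.1) (finsetOf Γ f.2.1) (finsetOf Γ f.2.2) 0) ∧
    (finsetOf Γ (FaceCensus.flipAt f.2.1 (Γ.bar f.1)) =
      cornersM (Elt.conj Γ) (finsetOf Γ f.1) (finsetOf Γ f.2.1) (finsetOf Γ f.2.2) 1) ∧
    (finsetOf Γ (FaceCensus.flipAt f.2.2 (Γ.bar f.1)) =
      cornersM (Elt.conj Γ) (finsetOf Γ f.1) (finsetOf Γ f.2.1) (finsetOf Γ f.2.2) 2) ∧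
    (finsetOf Γ (FaceCensus.flipAt f.2.2 (FaceCensus.flipAt f.2.1 f.1)) =
      cornersM (Elt.conj Γ) (finsetOf Γ f.1) (finsetOf Γ f.2.1) (finsetOf Γ f.2.2) 3) := by
  simp [cornersM, finsetOf_flipAt, finsetOf_bar, flip]

/-- **SumTwo holds for every face** of every table: a CM type and two disjoint places. -/
theorem sumTwo_eq_true (Γ : CMGaloisType n) [Fact (Γ.isCMGaloisType = true)] {T p q : ℕ}
    (hT : Γ.isCMType T = true) (hd : Disjoint (finsetOf Γ p) (finsetOf Γ q)) :
    Γ.sumTwo (T, p, q) = true := by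
  rw [sumTwo_iff]
  intro i
  have hΦ : IsCMType (Elt.conj Γ) (finsetOf Γ T) := ((isCMType_iff Γ T).1 hT).2
  have hbar := smul_mem_iff_of_isCMType (Elt.isComplexConj_conj Γ) hΦ
  have h := sum_four_corners (π := finsetOf Γ p) (π' := finsetOf Γ q) hbar hd (Elt.ofIdx Γ i)
  simp only [flip, ← finsetOf_flipAt, ← finsetOf_bar, mem_finsetOf, Elt.idx_ofIdx] at h
  simpa using h

/-! ### The face list -/

/-- Membership in the engine's sorted insertion. -/
theorem mem_insertNat (a b : ℕ) (l : List ℕ) : b ∈ insertNat a l ↔ b = a ∨ b ∈ l := by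
  induction l with
  | nil => simp [insertNat]
  | cons c l ih =>
    simp only [insertNat]
    split_ifs
    · simp
    · rw [List.mem_cons, ih, List.mem_cons]
      tauto

/-- The engine's insertion sort preserves membership. -/
theorem mem_sortNat (a : ℕ) (l : List ℕ) : a ∈ sortNat l ↔ a ∈ l := by
  induction l with
  | nil => simp [sortNat]
  | cons c l ih =>
    simp only [sortNat, mem_insertNat, ih, List.mem_cons]

/-- The engine's `normalize` (sort and erase duplicates) preserves membership. -/
theorem mem_normalize (a : ℕ) (S : List ℕ) : a ∈ normalize S ↔ a ∈ S := by
  show a ∈ (sortNat S).eraseDups ↔ a ∈ S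
  rw [List.mem_eraseDups, mem_sortNat]

/-- The engine's place list: the masks `placeMask i`, `i : Fin n`. -/
theorem mem_places (Γ : CMGaloisType n) (p : ℕ) : p ∈ Γ.places ↔ ∃ i : Fin n, p = Γ.placeMask i := by
  rw [CMGaloisType.places, mem_normalize, List.mem_map]
  simp only [List.mem_finRange, true_and]
  exact ⟨fun ⟨i, h⟩ => ⟨i, h.symm⟩, fun ⟨i, h⟩ => ⟨i, h.symm⟩⟩

/-- The engine's CM-type list: the masks `T < 2^n` passing `isCMType`. -/
theorem mem_cmTypes (Γ : CMGaloisType n) (T : ℕ) : T ∈ Γ.cmTypes ↔ T < 2 ^ n ∧ Γ.isCMType T = true := by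
  rw [CMGaloisType.cmTypes, List.mem_filter, List.mem_range]

/-- The engine's face list: a CM type and two distinct places. -/
theorem mem_faces (Γ : CMGaloisType n) (f : ℕ × ℕ × ℕ) :
    f ∈ Γ.faces ↔ f.1 ∈ Γ.cmTypes ∧ f.2.1 ∈ Γ.places ∧ f.2.2 ∈ Γ.places ∧ f.2.2 ≠ f.2.1 := by
  obtain ⟨T, p, q⟩ := f
  simp only [CMGaloisType.faces, List.mem_flatMap, List.mem_map, List.mem_filter, bne_iff_ne, ne_eq,
    Prod.mk.injEq]
  constructor
  · rintro ⟨T', hT', p', hp', q', ⟨hq', hqp'⟩, rfl, rfl, rfl⟩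
    exact ⟨hT', hp', hq', hqp'⟩
  · rintro ⟨hT, hp, hq, hqp⟩
    exact ⟨T, hT, p, hp, q, ⟨hq, hqp⟩, rfl, rfl, rfl⟩

/-- A singleton mask is below `2^n`. -/
theorem bit_lt (i : Fin n) : bit i < 2 ^ n := Nat.pow_lt_pow_right (by norm_num) i.isLt

/-- A place mask is below `2^n`. -/
theorem placeMask_lt (Γ : CMGaloisType n) (i : Fin n) : Γ.placeMask i < 2 ^ n :=
  Nat.or_lt_two_pow (bit_lt i) (bit_lt _)

/-- Masks below `2^n` are determined by their finsets. -/
theorem finsetOf_injOn (Γ : CMGaloisType n) {p q : ℕ} (hp : p < 2 ^ n) (hq : q < 2 ^ n)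
    (h : finsetOf Γ p = finsetOf Γ q) : p = q := by
  apply Nat.eq_of_testBit_eq
  intro i
  by_cases hi : i < n
  · have := congrArg (fun S => Elt.ofIdx Γ ⟨i, hi⟩ ∈ S) h
    simp only [mem_finsetOf', Elt.idx_ofIdx, eq_iff_iff] at this
    cases hpi : p.testBit i <;> cases hqi : q.testBit i <;> simp_all
  · rw [Nat.testBit_eq_false_of_lt (lt_of_lt_of_le hp (Nat.pow_le_pow_right (by norm_num) (not_lt.1 hi))),
      Nat.testBit_eq_false_of_lt (lt_of_lt_of_le hq (Nat.pow_le_pow_right (by norm_num) (not_lt.1 hi)))]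

/-- Distinct places are disjoint. -/
theorem disjoint_finsetOf_places (Γ : CMGaloisType n) [Fact (Γ.isCMGaloisType = true)] {p q : ℕ}
    (hp : p ∈ Γ.places) (hq : q ∈ Γ.places) (hpq : p ≠ q) :
    Disjoint (finsetOf Γ p) (finsetOf Γ q) := by
  obtain ⟨i, rfl⟩ := (mem_places Γ p).1 hp
  obtain ⟨j, rfl⟩ := (mem_places Γ q).1 hq
  rw [finsetOf_placeMask, finsetOf_placeMask]
  rcases place_eq_or_disjoint (Elt.isComplexConj_conj Γ) (Elt.ofIdx Γ i) (Elt.ofIdx Γ j) with h | h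
  · exact absurd (finsetOf_injOn Γ (placeMask_lt Γ i) (placeMask_lt Γ j)
      (by rw [finsetOf_placeMask, finsetOf_placeMask]; exact h)) hpq
  · exact h

/-- **Every face of every table satisfies `sumTwo`**: the μ-table of a face has all column sums `2`. -/
theorem sumTwo_of_mem_faces (Γ : CMGaloisType n) [Fact (Γ.isCMGaloisType = true)] {f : ℕ × ℕ × ℕ}
    (hf : f ∈ Γ.faces) : Γ.sumTwo f = true := by
  obtain ⟨T, p, q⟩ := f
  obtain ⟨hT, hp, hq, hqp⟩ := (mem_faces Γ (T, p, q)).1 hf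
  exact sumTwo_eq_true Γ ((mem_cmTypes Γ T).1 hT).2 (disjoint_finsetOf_places Γ hp hq (Ne.symm hqp))

/-- The engine's `faces.all sumTwo` check is always `true` for a good table. -/
theorem faces_all_sumTwo (Γ : CMGaloisType n) [Fact (Γ.isCMGaloisType = true)] :
    Γ.faces.all Γ.sumTwo = true := by
  rw [List.all_eq_true]
  intro f hf
  exact sumTwo_of_mem_faces Γ hf

/-! ### `noConjugateCorners` in the model -/

/-- `noConjugateCorners f` says that no corner is the conjugate of a corner. -/
theorem noConjugateCorners_iff (Γ : CMGaloisType n) (f : ℕ × ℕ × ℕ) :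
    Γ.noConjugateCorners f = true ↔ ∀ L ∈ Γ.corners f, Γ.bar L ∉ Γ.corners f := by
  simp only [CMGaloisType.noConjugateCorners, List.all_eq_true, Bool.not_eq_eq_eq_not, Bool.not_true,
    List.contains_eq_mem, decide_eq_false_iff_not]

end EngineBridge

end HodgeRepro
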